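import Summits.QuantumFields.BalabanUV.T4Continuum.Support.RegionLocalInjectedAssembly
import Summits.QuantumFields.BalabanUV.T4Continuum.Support.RegionNormPairingTools

/-!
# T⁴ programme, spine node NE2 (U1a), sub-row Δ1 «NE2⁰-Dirichlet» — THE CRUDE TWO-LEVEL PAIRING OF THE LOCAL OPERATOR IN THE `Ebud`
# CURRENCY (the `k = 0` rung of the (P-W) socket, and its splice with a geometric bound from rung 1 on; owner item O15-g)

Row NE2 OWNER (unit `b2b-balaban-t4-ne2-p1`, gen 15).  The displayed (P-W) socket of the END of record
(`RegionLocalInjectedAssembly.towerLimitRate_star_renorm_box_of_WPairing` p239590, `RegionLocalInjectedAssemblyTrace.…_of_WPairing_hB` p240493)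
asks for EVERY `k`, including the first rung `k = 0` (`lev L 0 = 1`), where the two-level first-order identity of the crew
(`StarCarrierTwoLevelIdentity.first_order_identity_lev`, `2 ≤ lev L k`) is not available.  This file supplies the trivial bound there, ON ANY
REGION AND ANY PAIR OF LEVELS, in the owner's master-budget currency `Ebud`, and the splice that turns «geometric from rung 1 on» into the
socket's `∀ k` shape with one constant.

 * §1 `regionDeltaLoc_zero_add_mass` (`Δ_loc(a) = Δ_loc(0) + (a n^d)•avgRᴴavgR`), **`sqrt_nsq_regionDeltaLoc_zero_le_Ebud`**:
   `√nsq(Δ_loc(0) w) ≤ (1 + a)·√(Ebud n M a S w)` (`0 ≤ a`; `RegionNormPairingTools.sqrt_nsq_mass_le`).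
 * §2 **`pairing_loc_crude`**: for ANY `J` with `‖J‖ ≤ 1` between the star bonds of two levels `n, n′` of one region,
   `‖⟨v, (J·Δ_loc(n,0) − Δ_loc(n′,0)·J) u⟩‖ ≤ 2(1 + a)·√(Ebud n M a S u)·√(Ebud n′ M a S v)`; tower spelling **`hPW_crude`** (every `k`,
   `J = JpR L M (starP L M S) k`, `‖J‖ ≤ 1` by `DirichletSubregionTowerOf.opNorm_JpR_le`).
 * §3 the splice **`rate_splice`** (`(if k = 0 then C₀ else ε k) ≤ max C₀ C_W · θ^k` from `ε k ≤ C_W θ^k` for `1 ≤ k`) and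
   **`hPW_of_succ`**: a pairing bound `ε k` valid for `1 ≤ k` gives the socket `∀ k` with `εW k := if k = 0 then 2(1 + a) else ε k`.

HONEST FRAMING (T4-DAG p. 1).  Finite-dimensional bookkeeping ([folklore]); neither (P-W) nor (B) is discharged here; NE2 (U1a) NOT proved;
spine PROVED 0/9 unchanged; NOT [B9] (3.16)/(3.23)–(3.27)/(3.42) as printed; NOT infinite volume / mass gap / Clay.  HONEST DEPENDENCY: continuum YM on
T⁴ ⇐ BetaPertH ∧ nine spine estimates (0/9 proved); BetaPertH ⇐ (D1) ∧ (D4) ∧ CAP+tail; G-an2-4 gates asym, D1 and NE2/3/4.  No `sorry`.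
-/

noncomputable section

open scoped BigOperators ComplexConjugate Matrix Matrix.Norms.L2Operator

namespace Summit.QuantumFields.BalabanUV.T4Continuum.RegionLocalPairingCrude

open Literature.MathematicalPhysics.QuantumFieldTheory.Balaban1983to89.B5Prop11Plancherel (Tor fine)
open Literature.MathematicalPhysics.QuantumFieldTheory.Balaban1983to89.B5Prop11Lower (nsq nsq_nonneg norm_star_dotProduct_le)
open Literature.MathematicalPhysics.QuantumFieldTheory.Balaban1983to89.B5G183RateUnitTower (lev)
open Summit.QuantumFields.BalabanUV.T4Continuum
open Summit.QuantumFields.BalabanUV.T4Continuum.RegionGaugeFixedVector (starReg curlR gradR avgR)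
open Summit.QuantumFields.BalabanUV.T4Continuum.DirichletSubregionTowerOf (pidx JpR opNorm_JpR_le)
open Summit.QuantumFields.BalabanUV.T4Continuum.DirichletStarVectorTower (starP)
open Summit.QuantumFields.BalabanUV.T4Continuum.DirichletDirectionalBesov (sqrt_nsq_sub_le)
open Summit.QuantumFields.BalabanUV.T4Continuum.RegionNormPairingTools (sqrt_nsq_mass_le sqrt_nsq_mulVec_le)
open Summit.QuantumFields.BalabanUV.T4Continuum.RegionGaugeResolventSplit (regionDeltaLoc regionDeltaLoc_eq regionDeltaLoc_isHermitian)
open Summit.QuantumFields.BalabanUV.T4Continuum.RegionLocalInjectedAssembly (Ebud Ebud_nonneg form_regionDeltaLoc_nonneg)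
open Summit.QuantumFields.BalabanUV.T4Continuum.RegionElectricSplitting (Wdir)

variable {d : ℕ}

/-! ## §1 The local operator at `a = 0` inside the master budget -/

section Mass

variable (n : ℕ) [NeZero n] (M : Fin d → ℕ) [hM : ∀ μ, NeZero (M μ)] (a : ℝ) (S : Tor M → Prop) [DecidablePred S]

/-- `Δ_loc(a) = Δ_loc(0) + (a·n^d)•avgRᴴ·avgR`. [folklore] -/
theorem regionDeltaLoc_zero_add_mass :
    regionDeltaLoc n M a S = regionDeltaLoc n M 0 S + ((a * (n : ℝ) ^ d : ℝ) : ℂ) • ((avgR n M S)ᴴ * avgR n M S) := by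
  rw [regionDeltaLoc_eq, regionDeltaLoc_eq, zero_mul, Complex.ofReal_zero, zero_smul, add_zero]

/-- `Δ_loc(0) w = Δ_loc(a) w − (a·n^d)•avgRᴴ(avgR w)`. [folklore] -/
theorem regionDeltaLoc_zero_mulVec (w : {b // starReg n M S b} → ℂ) :
    regionDeltaLoc n M 0 S *ᵥ w
      = regionDeltaLoc n M a S *ᵥ w - ((a * (n : ℝ) ^ d : ℝ) : ℂ) • ((avgR n M S)ᴴ *ᵥ (avgR n M S *ᵥ w)) := by
  rw [regionDeltaLoc_zero_add_mass n M a S, Matrix.add_mulVec, Matrix.smul_mulVec, ← Matrix.mulVec_mulVec, add_sub_cancel_right]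

/-- `√nsq(Δ_loc(0) w) ≤ √nsq(Δ_loc(a) w) + a·√nsq w` (`0 ≤ a`). [folklore] -/
theorem sqrt_nsq_regionDeltaLoc_zero_le (ha : 0 ≤ a) (w : {b // starReg n M S b} → ℂ) :
    Real.sqrt (nsq (regionDeltaLoc n M 0 S *ᵥ w))
      ≤ Real.sqrt (nsq (regionDeltaLoc n M a S *ᵥ w)) + a * Real.sqrt (nsq w) := by
  rw [regionDeltaLoc_zero_mulVec n M a S w]
  exact (sqrt_nsq_sub_le _ _).trans (by gcongr; exact sqrt_nsq_mass_le n M S ha w)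

/-- `nsq w ≤ Ebud w` (`0 ≤ a`). [folklore] -/
theorem nsq_le_Ebud (ha : 0 ≤ a) (w : {b // starReg n M S b} → ℂ) : nsq w ≤ Ebud n M a S w := by
  unfold Ebud
  have h1 := form_regionDeltaLoc_nonneg n M a S ha w
  have h2 : 0 ≤ ∑ μ, nsq (Wdir n M S μ *ᵥ w) := Finset.sum_nonneg fun μ _ => nsq_nonneg _
  have h3 := nsq_nonneg (regionDeltaLoc n M a S *ᵥ w)
  linarith

/-- `nsq (Δ_loc(a) w) ≤ Ebud w` (`0 ≤ a`). [folklore] -/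
theorem nsq_regionDeltaLoc_le_Ebud (ha : 0 ≤ a) (w : {b // starReg n M S b} → ℂ) :
    nsq (regionDeltaLoc n M a S *ᵥ w) ≤ Ebud n M a S w := by
  unfold Ebud
  have h1 := form_regionDeltaLoc_nonneg n M a S ha w
  have h2 : 0 ≤ ∑ μ, nsq (Wdir n M S μ *ᵥ w) := Finset.sum_nonneg fun μ _ => nsq_nonneg _
  have h3 := nsq_nonneg w
  linarith

/-- **`√nsq(Δ_loc(0) w) ≤ (1 + a)·√(Ebud n M a S w)`** (`0 ≤ a`; any region, any level). [folklore] -/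
theorem sqrt_nsq_regionDeltaLoc_zero_le_Ebud (ha : 0 ≤ a) (w : {b // starReg n M S b} → ℂ) :
    Real.sqrt (nsq (regionDeltaLoc n M 0 S *ᵥ w)) ≤ (1 + a) * Real.sqrt (Ebud n M a S w) := by
  have h1 : Real.sqrt (nsq (regionDeltaLoc n M a S *ᵥ w)) ≤ Real.sqrt (Ebud n M a S w) :=
    Real.sqrt_le_sqrt (nsq_regionDeltaLoc_le_Ebud n M a S ha w)
  have h2 : Real.sqrt (nsq w) ≤ Real.sqrt (Ebud n M a S w) := Real.sqrt_le_sqrt (nsq_le_Ebud n M a S ha w)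
  calc Real.sqrt (nsq (regionDeltaLoc n M 0 S *ᵥ w))
      ≤ Real.sqrt (nsq (regionDeltaLoc n M a S *ᵥ w)) + a * Real.sqrt (nsq w) := sqrt_nsq_regionDeltaLoc_zero_le n M a S ha w
    _ ≤ Real.sqrt (Ebud n M a S w) + a * Real.sqrt (Ebud n M a S w) := by gcongr
    _ = (1 + a) * Real.sqrt (Ebud n M a S w) := by ring

end Mass

/-! ## §2 The crude pairing: any contraction `J`, any two levels of one region -/

section Pairing

variable (M : Fin d → ℕ) [hM : ∀ μ, NeZero (M μ)] (a : ℝ) (S : Tor M → Prop) [DecidablePred S]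

/-- `⟨v, A x⟩ = ⟨Aᴴ v, x⟩` — for a Hermitian `A`, `⟨v, A x⟩ = ⟨A v, x⟩`. [folklore] -/
theorem star_dotProduct_mulVec_eq {m : Type*} [Fintype m] {A : Matrix m m ℂ} (hA : A.IsHermitian) (v x : m → ℂ) :
    star v ⬝ᵥ (A *ᵥ x) = star (A *ᵥ v) ⬝ᵥ x := by
  conv_rhs => rw [← hA.eq]
  rw [Matrix.star_mulVec, Matrix.conjTranspose_conjTranspose, Matrix.dotProduct_mulVec]

/-- **THE CRUDE TWO-LEVEL PAIRING OF THE LOCAL OPERATOR**: for any `J` with `‖J‖ ≤ 1` from the star bonds of level `n` to those of level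
`n′` of one region and `0 ≤ a`,
`‖⟨v, (J·Δ_loc(n,0) − Δ_loc(n′,0)·J) u⟩‖ ≤ 2(1 + a)·√(Ebud n M a S u)·√(Ebud n′ M a S v)`. [folklore] -/
theorem pairing_loc_crude (n n' : ℕ) [NeZero n] [NeZero n'] (ha : 0 ≤ a)
    (J : Matrix {b // starReg n' M S b} {b // starReg n M S b} ℂ) (hJ : ‖J‖ ≤ 1)
    (u : {b // starReg n M S b} → ℂ) (v : {b // starReg n' M S b} → ℂ) :
    ‖star v ⬝ᵥ ((J * regionDeltaLoc n M 0 S - regionDeltaLoc n' M 0 S * J) *ᵥ u)‖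
      ≤ 2 * (1 + a) * Real.sqrt (Ebud n M a S u) * Real.sqrt (Ebud n' M a S v) := by
  have hEu := Real.sqrt_nonneg (Ebud n M a S u)
  have hEv := Real.sqrt_nonneg (Ebud n' M a S v)
  have ha1 : 0 ≤ 1 + a := by linarith
  rw [Matrix.sub_mulVec, ← Matrix.mulVec_mulVec, ← Matrix.mulVec_mulVec, dotProduct_sub,
    star_dotProduct_mulVec_eq (regionDeltaLoc_isHermitian n' M 0 S) v (J *ᵥ u)]
  -- first term `⟨v, J(Δ₀ u)⟩`
  have t1 : ‖star v ⬝ᵥ (J *ᵥ (regionDeltaLoc n M 0 S *ᵥ u))‖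
      ≤ Real.sqrt (Ebud n' M a S v) * ((1 + a) * Real.sqrt (Ebud n M a S u)) := by
    refine (norm_star_dotProduct_le _ _).trans (mul_le_mul (Real.sqrt_le_sqrt (nsq_le_Ebud n' M a S ha v)) ?_
      (Real.sqrt_nonneg _) hEv)
    calc Real.sqrt (nsq (J *ᵥ (regionDeltaLoc n M 0 S *ᵥ u)))
        ≤ ‖J‖ * Real.sqrt (nsq (regionDeltaLoc n M 0 S *ᵥ u)) := sqrt_nsq_mulVec_le _ _
      _ ≤ 1 * ((1 + a) * Real.sqrt (Ebud n M a S u)) :=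
          mul_le_mul hJ (sqrt_nsq_regionDeltaLoc_zero_le_Ebud n M a S ha u) (Real.sqrt_nonneg _) zero_le_one
      _ = (1 + a) * Real.sqrt (Ebud n M a S u) := one_mul _
  -- second term `⟨Δ₀′ v, J u⟩`
  have t2 : ‖star (regionDeltaLoc n' M 0 S *ᵥ v) ⬝ᵥ (J *ᵥ u)‖
      ≤ (1 + a) * Real.sqrt (Ebud n' M a S v) * Real.sqrt (Ebud n M a S u) := by
    refine (norm_star_dotProduct_le _ _).trans (mul_le_mul (sqrt_nsq_regionDeltaLoc_zero_le_Ebud n' M a S ha v) ?_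
      (Real.sqrt_nonneg _) (mul_nonneg ha1 hEv))
    calc Real.sqrt (nsq (J *ᵥ u)) ≤ ‖J‖ * Real.sqrt (nsq u) := sqrt_nsq_mulVec_le _ _
      _ ≤ 1 * Real.sqrt (Ebud n M a S u) :=
          mul_le_mul hJ (Real.sqrt_le_sqrt (nsq_le_Ebud n M a S ha u)) (Real.sqrt_nonneg _) zero_le_one
      _ = Real.sqrt (Ebud n M a S u) := one_mul _
  calc ‖star v ⬝ᵥ (J *ᵥ (regionDeltaLoc n M 0 S *ᵥ u)) - star (regionDeltaLoc n' M 0 S *ᵥ v) ⬝ᵥ (J *ᵥ u)‖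
      ≤ ‖star v ⬝ᵥ (J *ᵥ (regionDeltaLoc n M 0 S *ᵥ u))‖ + ‖star (regionDeltaLoc n' M 0 S *ᵥ v) ⬝ᵥ (J *ᵥ u)‖ := norm_sub_le _ _
    _ ≤ Real.sqrt (Ebud n' M a S v) * ((1 + a) * Real.sqrt (Ebud n M a S u))
          + (1 + a) * Real.sqrt (Ebud n' M a S v) * Real.sqrt (Ebud n M a S u) := add_le_add t1 t2
    _ = 2 * (1 + a) * Real.sqrt (Ebud n M a S u) * Real.sqrt (Ebud n' M a S v) := by ring

/-- **THE CRUDE PAIRING ALONG THE TOWER** (every `k`, in particular the first rung `k = 0`; `‖J_R‖ ≤ 1`): the (P-W) socket's left side is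
at most `2(1 + a)·√E(u)·√E(v)`. [folklore] -/
theorem hPW_crude (L : ℕ) [NeZero L] (ha : 0 ≤ a) (k : ℕ)
    (u : pidx L M (starP L M S) k → ℂ) (v : pidx L M (starP L M S) (k + 1) → ℂ) :
    ‖star v ⬝ᵥ ((JpR L M (starP L M S) k * regionDeltaLoc (lev L k) M 0 S
        - regionDeltaLoc (lev L (k + 1)) M 0 S * JpR L M (starP L M S) k) *ᵥ u)‖
      ≤ 2 * (1 + a) * Real.sqrt (Ebud (lev L k) M a S u) * Real.sqrt (Ebud (lev L (k + 1)) M a S v) :=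
  pairing_loc_crude M a S (lev L k) (lev L (k + 1)) ha (JpR L M (starP L M S) k) (opNorm_JpR_le L M (starP L M S) k) u v

end Pairing

/-! ## §3 The splice: geometric from rung 1 on + the crude first rung ⟹ the socket for every `k` -/

/-- **RATE SPLICE**: `ε k ≤ C_W·θ^k` for `1 ≤ k` and `0 ≤ θ` ⟹ `(if k = 0 then C₀ else ε k) ≤ max C₀ C_W · θ^k` for every `k`. [folklore] -/
theorem rate_splice {ε : ℕ → ℝ} {C₀ CW θ : ℝ} (hθ : 0 ≤ θ) (hrate : ∀ k, 1 ≤ k → ε k ≤ CW * θ ^ k) (k : ℕ) :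
    (if k = 0 then C₀ else ε k) ≤ max C₀ CW * θ ^ k := by
  rcases Nat.eq_zero_or_pos k with hk | hk
  · subst hk; rw [if_pos rfl, pow_zero, mul_one]; exact le_max_left _ _
  · rw [if_neg (Nat.pos_iff_ne_zero.mp hk)]
    exact (hrate k hk).trans (mul_le_mul_of_nonneg_right (le_max_right _ _) (pow_nonneg hθ k))

/-- the spliced rate is nonnegative when `0 ≤ C₀` and `0 ≤ ε k` for `1 ≤ k`. [folklore] -/
theorem splice_nonneg {ε : ℕ → ℝ} {C₀ : ℝ} (hC : 0 ≤ C₀) (hε : ∀ k, 1 ≤ k → 0 ≤ ε k) (k : ℕ) :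
    0 ≤ (if k = 0 then C₀ else ε k) := by
  split_ifs with hk
  · exact hC
  · exact hε k (Nat.pos_iff_ne_zero.mpr hk)

section Socket

variable (M : Fin d → ℕ) [hM : ∀ μ, NeZero (M μ)] (a : ℝ) (S : Tor M → Prop) [DecidablePred S]

/-- **THE (P-W) SOCKET FROM RUNG 1 ON**: a pairing bound `ε k` valid for `1 ≤ k` gives the END of record's `hPW` for EVERY `k` with
`εW k := if k = 0 then 2(1 + a) else ε k` (`0 ≤ a`; any region). [folklore] -/
theorem hPW_of_succ (L : ℕ) [NeZero L] (ha : 0 ≤ a) {ε : ℕ → ℝ}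
    (hPW1 : ∀ (k : ℕ) (u : pidx L M (starP L M S) k → ℂ) (v : pidx L M (starP L M S) (k + 1) → ℂ), 1 ≤ k →
      ‖star v ⬝ᵥ ((JpR L M (starP L M S) k * regionDeltaLoc (lev L k) M 0 S
          - regionDeltaLoc (lev L (k + 1)) M 0 S * JpR L M (starP L M S) k) *ᵥ u)‖
        ≤ ε k * Real.sqrt (Ebud (lev L k) M a S u) * Real.sqrt (Ebud (lev L (k + 1)) M a S v))
    (k : ℕ) (u : pidx L M (starP L M S) k → ℂ) (v : pidx L M (starP L M S) (k + 1) → ℂ) :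
    ‖star v ⬝ᵥ ((JpR L M (starP L M S) k * regionDeltaLoc (lev L k) M 0 S
        - regionDeltaLoc (lev L (k + 1)) M 0 S * JpR L M (starP L M S) k) *ᵥ u)‖
      ≤ (if k = 0 then 2 * (1 + a) else ε k) * Real.sqrt (Ebud (lev L k) M a S u) * Real.sqrt (Ebud (lev L (k + 1)) M a S v) := by
  split_ifs with hk
  · subst hk; exact hPW_crude M a S L ha 0 u v
  · exact hPW1 k u v (Nat.pos_iff_ne_zero.mpr hk)

/-- the spliced (P-W) rate: `0 ≤ εW k` and `εW k ≤ max (2(1+a)) C_W · θ^k` from `0 ≤ ε k ≤ C_W θ^k` (`1 ≤ k`), `0 ≤ a`, `0 ≤ θ` — the two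
rate hypotheses `hεW`, `hrate` of the END of record. [folklore] -/
theorem hPW_rate_of_succ (ha : 0 ≤ a) {ε : ℕ → ℝ} {CW θ : ℝ} (hθ : 0 ≤ θ) (hε : ∀ k, 1 ≤ k → 0 ≤ ε k)
    (hrate : ∀ k, 1 ≤ k → ε k ≤ CW * θ ^ k) :
    (∀ k, 0 ≤ (if k = 0 then 2 * (1 + a) else ε k))
      ∧ ∀ k, (if k = 0 then 2 * (1 + a) else ε k) ≤ max (2 * (1 + a)) CW * θ ^ k :=
  ⟨splice_nonneg (by linarith) hε, rate_splice hθ hrate⟩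

end Socket

end Summit.QuantumFields.BalabanUV.T4Continuum.RegionLocalPairingCrude

end
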